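import Literature.MathematicalPhysics.QuantumFieldTheory.Balaban1983to89.Beta.KernelRepresentation
import Literature.MathematicalPhysics.QuantumFieldTheory.Balaban1983to89.Beta.DecimatedMomentSummable

/-!
# Bałaban, *Renormalization group approach to lattice gauge field theories. I* (Comm. Math. Phys. 109 (1987)
# 249–301) — β-function sub-cell, AN2/(Y17) caveats (δ)/(ε), OPERATOR SIDE: the kernel representation of the
# covariant affine-reproducing map `H` with INFINITELY EXTENDED kernel entries, and the windowed low-moment
# identities (L0∞)/(L1∞) it forces (unconditional sums over `ℤ^d`)

HONEST FRAMING.  This module, like `Beta/KernelRepresentation` which it extends, formalises NO statement printed in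
[Balaban1987RG1]: it is kernel-checked lattice algebra and elementary analysis ([folklore] throughout) supporting the
cell's reading (D-a) of the polarisation operator (1.17)–(1.22) (the right averaging data of `Π` are response kernels of
the minimiser, which reproduces affine data).  The cite tag carries context only; nothing here is attributed to print.

`Beta/KernelRepresentation` typed the map `H : coarse 1-forms → fine 1-forms` of an
`AffineReproduction.InfiniteVolumeSpec` as a kernel map `kernelOp N w` with FINITELY SUPPORTED matrix entries
`w κ l : LatFun d ℝ` and derived, from the spec's exact reproduction of constants / affine 1-forms
(`AffineReproduction.round1` / `hAff_of_spec`), the windowed identities (L0)/(L1) of `Beta/DecimatedMoment` for every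
entry.  Its header names the idealisation: the minimiser's kernels are infinitely extended (exponentially localised),
so the finitely supported typing is a caveat — recorded by the cell as AN2 (Y17) caveat (δ) («finitely supported
matrix kernel vs exponentially decaying: to be lifted by a `DecimatedMomentLimit`-type passage») and, for the
downstream identities, caveat (ε).  `Beta/DecimatedMomentSummable` lifted (ε) on the IDENTITY side (the dressed /
decimated second-moment identity for infinitely extended patterns, from (L0∞)/(L1∞) :=
`ConstReproSum`/`LinReproSum`).  THIS FILE lifts (δ)/(ε) on the OPERATOR side: the same kernel map with ARBITRARY
entries `w κ l : ℤ^d → ℝ`, summed unconditionally, and the derivation spec ⟹ (L0∞)/(L1∞) — so that the chain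
«kernel-represented spec ⟹ windowed second-moment identity» now runs end to end for infinitely extended kernels
(`decimatedSum_second_moment_of_spec`).

WHAT IS IN PRINT (context locators only, as already carried verbatim by `Beta/InfiniteVolume`, `B12Beta`, `B12Sec2to5`,
`Beta/DecimatedMomentLimit`).  [Balaban1987RG1] p. 264 [PDF 16], before (1.22): «Now we take a limit of these functions
as T^{(j+1)} ↗ Z^d. This limit exists by the localized representation (1.7).»; p. 293 [PDF 45], (5.10):
«|Π_{μν}(x − y)| ≦ O(1)E₀ exp(−δ₁|x − y|)» (typed `B12Sec2to5.Decay510`, which implies the hypothesis `AbsMoment₂` used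
here: `DecimatedMomentSummable.absMoment₂_of_decay510`).  That the minimiser's response kernels are infinitely extended
and exponentially localised is the cell records' reading (AN2 §11; their locators B5 (1.63), B11 (190)) — no quotation
is attached and nothing of it is asserted here.

WHAT THIS FILE PROVES (all [folklore]; over `ℝ`; `N` arbitrary unless `N ≠ 0` / `[NeZero N]` is stated).
* §1 `summand`, `kernelOpSum N w b κ x := Σ_l Σ'_z cosetInd N (x − z) • (w κ l z · b l ((x − z)/N))` — the summand of
  `KernelRepresentation.kernelOp`, as a `tsum` over `ℤ^d`; `kernelOpSum_finsupp`: on `Finsupp` entries it IS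
  `kernelOp`; the `y`-FORM `tsum_summand_eq_decimated` / `kernelOpSum_apply_eq_decimated` (`N ≠ 0`):
  `(K b)_κ(x) = Σ_l Σ'_y w_{κl}(x − N y) · b_l(y)` — the literal operator with kernel `H(x, y) = w(x − N y)`;
  `hasSum_coset_iff_decimated` and the `y`-forms of the two reproduction predicates, `constReproSum_iff_decimated`
  (every ROW of `H` sums to `σ`) / `linReproSum_iff_decimated`.
* §2 `kernelOpSum_trans1` — BLOCK-TRANSLATION COVARIANCE for all data, termwise (no summability);
  `kernelOpSum_add_of_summable`; the two `InfiniteVolumeSpec` fields in their exact shape: `kernelOpSum_H_cov`,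
  `kernelOpSum_H_add` (entries with absolutely summable second moments; additivity on affine data via
  `summable_summand_of_isAffine`).
* §3 `kernelOpSum_cst` (unconditionally, `tsum_mul_right`); `cM0Sum`/`cM1Sum` (coset moments as `tsum`s; `= cM0`/`cM1`
  on `Finsupp` entries), `hasSum_cM0Sum` (summable entry) / `hasSum_cM1Sum` (`AbsMoment₂` entry);
  **`constReproSum_of_reproduces`**: reproduction of constants by a kernel map with SUMMABLE entries ⟹
  `ConstReproSum N (w κ l) (δ_{κl}/N^(d+1))` for every entry.
* §4 `summand_affine_eq` / `hasSum_summand_affine` (the summand family on `affine (N • m) γ` HAS the sum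
  `Σ_j m_{lj}(x_j S0 − S1_j) + γ_l S0`, by `KernelRepresentation.cosetInd_mul_quot` and linearity of `HasSum`),
  `kernelOpSum_affine` (the shape of `KernelRepresentation.kernelOp_affine` with `cM0Sum`/`cM1Sum`), and
  **`linReproSum_of_reproduces`**: reproduction of affine 1-forms (entries `AbsMoment₂`) ⟹
  `∃ C, LinReproSum N (w κ l) C` — the algebra of `KernelRepresentation.linRepro_of_reproduces` verbatim on the sums
  (test forms `affine (unitMat l j) 0`).
* §5 for every `S : InfiniteVolumeSpec d N` with `S.H = kernelOpSum N w`: `constReproSum_of_spec`, `rowSum_of_spec`,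
  `linReproSum_of_spec`, `lowMomentsSum_of_spec`, and END TO END **`decimatedSum_second_moment_of_spec`**: with any
  middle factor `T` (`AbsMoment₂`, (T0)/(T1)) the coset second-moment family of the dressed kernel
  `w_{κl} ⋆ T ⋆ w_{κ'l'}` has the sum `(δ_{κl}/N^(d+1)) · m₂(T) · Σ' w_{κ'l'}`, in the fine form on
  `ℤ^d × ℤ^d × ℤ^d` and in the coarse form over `ℤ^d` (`DecimatedMomentSummable.decimatedSum_second_moment_hasSum`
  + `hasSum_coarse`).
* §6 (T0∞)/(T1∞) for an infinitely extended middle factor from its two position-space symmetries: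
  `hasSum_zero_of_divFree`, `hasSum_first_zero_of_inversion`, `lowMomentsSum_of_symmetries` — the `tsum` versions of
  `DecimatedMoment.M0_eq_zero_of_divFree` / `M1_eq_zero_of_inversion` / `low_moments_of_symmetries`.

NOT DONE HERE (said plainly).  (i) No INSTANCE of `InfiniteVolumeSpec` is constructed and no theorem says that
Bałaban's minimiser `H = 𝒬*G⁻¹(𝒬*)ᵀ…` IS `kernelOpSum N w` for response kernels `w` with `AbsMoment₂` — that is the
(O1′)/(O1′-dom) construction item of the β lead's spec, untouched; here `S.H = kernelOpSum N w` and `AbsMoment₂ (w κ l)`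
are HYPOTHESES.  (ii) Whether the actual middle factor of `Π` has the two symmetries of §6 is the cell's reading (D-a),
not proved.  (iii) Nothing on (H-aff)_k, (Q-aff), (I4′), the sign of the β-coefficient, or any renormalisation-group
statement.  (iv) `kernelOpSum` uses `tsum` (junk value `0` on non-summable families); every identity proved about it is
either termwise or carries its summability hypothesis explicitly.
-/

namespace Literature.MathematicalPhysics.QuantumFieldTheory.Balaban1983to89.Beta.KernelRepresentationSummable

open AffineAveraging (Form1 affine contourSum contourSum_affine)
open AffineReproduction (trans1 trans1_apply cst cst_apply IsAffine InfiniteVolumeSpec hAff_of_spec round1)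
open MomentFactorisation (LatFun moment)
open DecimatedMoment (cosetInd)
open DecimatedMomentLimit (abs_cosetInd_le_one hasSum_decimate_iff tsum_decimate)
open DecimatedMomentSummable (term IsMoment₂ MonoSummable ConstReproSum LinReproSum dressedSum AbsMoment₂
  hasSum_coarse decimatedSum_second_moment_hasSum monoSummable_of_absMoment₂ summable_window_smul_of_absMoment₂
  summable_smul_of_absMoment₂ summable_of_absMoment₂ summable_dressed_fibre)
open KernelRepresentation (kernelOp contourSum_cst cM0 cM1 cosetInd_mul_quot unitMat)

variable {d N : ℕ}

/-! ## §1 The kernel map with infinitely extended entries -/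

/-- One summand of the kernel map: the entry value `f z` at the fine point `z`, the coarse datum `g` read at the exact
quotient `(x − z)/N`, switched on exactly when `z ≡ x (mod N)`. [folklore] -/
def summand (N : ℕ) (f g : (Fin d → ℤ) → ℝ) (x z : Fin d → ℤ) : ℝ :=
  cosetInd N (x - z) • (f z * g (fun i => (x - z) i / (N : ℤ)))

/-- **The kernel map of a block-translation-covariant matrix kernel with ARBITRARY (possibly infinitely extended)
entries** `w κ l : ℤ^d → ℝ`:  `(K b)_κ(x) = Σ_l Σ'_{z ≡ x (N)} w_{κl}(z) · b_l((x − z)/N)` — the summand of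
`KernelRepresentation.kernelOp`, summed unconditionally over `ℤ^d` (`tsum`; junk value `0` on a non-summable family,
which never occurs below: every use is through a `HasSum` statement or under a summability hypothesis). [folklore] -/
noncomputable def kernelOpSum (N : ℕ) (w : Fin d → Fin d → (Fin d → ℤ) → ℝ) (b : Form1 d ℝ) : Form1 d ℝ :=
  fun κ x => ∑ l, ∑' z, summand N (w κ l) (b l) x z

/-- CONSISTENCY: on finitely supported entries `kernelOpSum` IS `KernelRepresentation.kernelOp`. [folklore] -/
theorem kernelOpSum_finsupp (w : Fin d → Fin d → LatFun d ℝ) (b : Form1 d ℝ) :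
    kernelOpSum N (fun κ l => ⇑(w κ l)) b = kernelOp N w b := by
  funext κ x
  simp only [kernelOpSum, kernelOp]
  refine Finset.sum_congr rfl fun l _ => ?_
  refine tsum_eq_sum fun z hz => ?_
  rw [summand, Finsupp.notMem_support_iff.1 hz, zero_mul, smul_zero]

/-- The `y`-FORM (for `N ≠ 0`): `Σ'_z summand = Σ'_y w(x − N y) · b(y)` — the literal kernel operator with kernel
`H(x, y) = w(x − N y)`, i.e. `H(x + N a, y + a) = H(x, y)`. [folklore] -/
theorem tsum_summand_eq_decimated (hN : N ≠ 0) (f g : (Fin d → ℤ) → ℝ) (x : Fin d → ℤ) :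
    ∑' z, summand N f g x z = ∑' y, f (x - (N : ℤ) • y) * g y := by
  have hNz : (N : ℤ) ≠ 0 := by exact_mod_cast hN
  have e1 : ∑' y, summand N f g x ((Equiv.subLeft x) y) = ∑' z, summand N f g x z :=
    (Equiv.subLeft x).tsum_eq (fun z => summand N f g x z)
  rw [← e1]
  have e2 : ∀ y, summand N f g x ((Equiv.subLeft x) y)
      = (cosetInd N y * (fun _ => (1 : ℤ)) y) • ((fun y' => f (x - y') * g (fun i => y' i / (N : ℤ))) y) := by
    intro y
    simp only [summand, Equiv.subLeft_apply, sub_sub_cancel, mul_one]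
  rw [tsum_congr e2, tsum_decimate hN]
  refine tsum_congr fun y => ?_
  simp only [one_smul]
  congr 2
  funext i
  simp only [Pi.smul_apply, smul_eq_mul]
  exact Int.mul_ediv_cancel_left _ hNz

/-- The `y`-form of the whole kernel map. [folklore] -/
theorem kernelOpSum_apply_eq_decimated (hN : N ≠ 0) (w : Fin d → Fin d → (Fin d → ℤ) → ℝ) (b : Form1 d ℝ)
    (κ : Fin d) (x : Fin d → ℤ) :
    kernelOpSum N w b κ x = ∑ l, ∑' y, w κ l (x - (N : ℤ) • y) * b l y := by
  simp only [kernelOpSum]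
  exact Finset.sum_congr rfl fun l _ => tsum_summand_eq_decimated hN (w κ l) (b l) x

/-- REINDEXING THROUGH THE COSET: a coset-windowed family `u ↦ (cosetInd N (x − u) · φ u) • f u` over `ℤ^d` has
the sum `s` iff the decimated family `y ↦ φ(x − N y) • f(x − N y)` has (`N ≠ 0`; `Equiv.subLeft x`, then
`DecimatedMomentLimit.hasSum_decimate_iff`). [folklore] -/
theorem hasSum_coset_iff_decimated (hN : N ≠ 0) (φ : (Fin d → ℤ) → ℤ) (f : (Fin d → ℤ) → ℝ) (x : Fin d → ℤ)
    (s : ℝ) :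
    HasSum (fun u => (cosetInd N (x - u) * φ u) • f u) s
      ↔ HasSum (fun y : Fin d → ℤ => φ (x - (N : ℤ) • y) • f (x - (N : ℤ) • y)) s := by
  have e := (Equiv.subLeft x).hasSum_iff (f := fun y => (cosetInd N y * φ (x - y)) • f (x - y)) (a := s)
  have e' : ((fun y => (cosetInd N y * φ (x - y)) • f (x - y)) ∘ (Equiv.subLeft x))
      = fun u => (cosetInd N (x - u) * φ u) • f u := by
    funext u
    simp only [Function.comp_apply, Equiv.subLeft_apply, sub_sub_cancel]
  rw [e'] at e
  exact e.trans (hasSum_decimate_iff hN (fun y => φ (x - y)) (fun y => f (x - y)) s).symm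

/-- **(L0∞) in the `y`-form**: `ConstReproSum N f σ` iff every ROW of the kernel `H(x, y) = f(x − N y)` has the sum
`σ`:  `∀ x, HasSum (y ↦ f (x − N y)) σ`. [folklore] -/
theorem constReproSum_iff_decimated (hN : N ≠ 0) (f : (Fin d → ℤ) → ℝ) (σ : ℝ) :
    ConstReproSum N f σ ↔ ∀ x, HasSum (fun y : Fin d → ℤ => f (x - (N : ℤ) • y)) σ := by
  refine forall_congr' fun x => ?_
  have h := hasSum_coset_iff_decimated hN (fun _ => (1 : ℤ)) f x σ
  simp only [mul_one, one_smul] at h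
  exact h

/-- **(L1∞) in the `y`-form**: `LinReproSum N f C` iff every first ROW MOMENT of the kernel `H(x, y) = f(x − N y)`
against the fine coordinate is `C`:  `∀ x κ, HasSum (y ↦ (x − N y)_κ • f (x − N y)) (C κ)`. [folklore] -/
theorem linReproSum_iff_decimated (hN : N ≠ 0) (f : (Fin d → ℤ) → ℝ) (C : Fin d → ℝ) :
    LinReproSum N f C ↔ ∀ x κ, HasSum (fun y : Fin d → ℤ => (x - (N : ℤ) • y) κ • f (x - (N : ℤ) • y)) (C κ) := by
  refine forall_congr' fun x => forall_congr' fun κ => ?_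
  exact hasSum_coset_iff_decimated hN (fun u => u κ) f x (C κ)

/-! ## §2 Covariance and additivity (the two automatic spec fields) -/

/-- The summand under a translation of the coarse datum = the summand at the block-translated fine point. [folklore] -/
theorem summand_trans (hN : N ≠ 0) (f g : (Fin d → ℤ) → ℝ) (a x z : Fin d → ℤ) :
    summand N f (fun y => g (y + a)) x z = summand N f g (x + (N : ℤ) • a) z := by
  have hNz : (N : ℤ) ≠ 0 := by exact_mod_cast hN
  have h1 : ∀ i, (x + (N : ℤ) • a - z) i = (x - z) i + (N : ℤ) * a i := fun i => by
    simp only [Pi.add_apply, Pi.sub_apply, Pi.smul_apply, smul_eq_mul]; ring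
  have hind : cosetInd N (x + (N : ℤ) • a - z) = cosetInd N (x - z) := by
    unfold cosetInd
    have : (∀ i, (N : ℤ) ∣ (x + (N : ℤ) • a - z) i) ↔ ∀ i, (N : ℤ) ∣ (x - z) i := by
      refine forall_congr' fun i => ?_
      rw [h1, dvd_add_left (dvd_mul_right _ _)]
    simp only [this]
  unfold summand
  rw [hind]
  unfold cosetInd
  split_ifs with h
  · have harg : ((fun i => (x - z) i / (N : ℤ)) + a : Fin d → ℤ) = fun i => (x + (N : ℤ) • a - z) i / (N : ℤ) := by
      funext i
      rw [Pi.add_apply, h1, Int.add_mul_ediv_left _ _ hNz]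
    rw [← harg]
  · rw [zero_smul, zero_smul]

/-- **BLOCK-TRANSLATION COVARIANCE** of `kernelOpSum` (field `H_cov` of `InfiniteVolumeSpec`, for ALL data; termwise,
no summability needed). [folklore] -/
theorem kernelOpSum_trans1 (hN : N ≠ 0) (w : Fin d → Fin d → (Fin d → ℤ) → ℝ) (a : Fin d → ℤ) (b : Form1 d ℝ) :
    kernelOpSum N w (trans1 a b) = trans1 ((N : ℤ) • a) (kernelOpSum N w b) := by
  funext κ x
  simp only [kernelOpSum, trans1_apply]
  refine Finset.sum_congr rfl fun l _ => tsum_congr fun z => ?_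
  exact summand_trans hN (w κ l) (b l) a x z

/-- The summand is additive in the coarse datum. [folklore] -/
theorem summand_add (f g g' : (Fin d → ℤ) → ℝ) (x z : Fin d → ℤ) :
    summand N f (g + g') x z = summand N f g x z + summand N f g' x z := by
  simp only [summand, Pi.add_apply, mul_add, smul_add]

/-- **ADDITIVITY** of `kernelOpSum` on data whose summand families are summable (`Summable.tsum_add`). [folklore] -/
theorem kernelOpSum_add_of_summable (w : Fin d → Fin d → (Fin d → ℤ) → ℝ) {b b' : Form1 d ℝ}
    (hb : ∀ κ l x, Summable (fun z => summand N (w κ l) (b l) x z))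
    (hb' : ∀ κ l x, Summable (fun z => summand N (w κ l) (b' l) x z)) :
    kernelOpSum N w (b + b') = kernelOpSum N w b + kernelOpSum N w b' := by
  funext κ x
  simp only [kernelOpSum, Pi.add_apply, ← Finset.sum_add_distrib]
  refine Finset.sum_congr rfl fun l _ => ?_
  rw [← (hb κ l x).tsum_add (hb' κ l x)]
  exact tsum_congr fun z => summand_add (w κ l) (b l) (b' l) x z

/-! ## §3 Constant data and (L0∞) -/

/-- The summand on a constant datum. [folklore] -/
theorem summand_const (f : (Fin d → ℤ) → ℝ) (c : ℝ) (x z : Fin d → ℤ) :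
    summand N f (fun _ => c) x z = (cosetInd N (x - z) • f z) * c := by
  simp only [summand, smul_mul_assoc]

/-- `kernelOpSum` on CONSTANT data: `Σ_l (Σ'_z cosetInd N (x − z) • w_{κl}(z)) · k_l` (unconditionally:
`tsum_mul_right`). [folklore] -/
theorem kernelOpSum_cst (w : Fin d → Fin d → (Fin d → ℤ) → ℝ) (k : Fin d → ℝ) (κ : Fin d) (x : Fin d → ℤ) :
    kernelOpSum N w (cst k) κ x = ∑ l, (∑' z, cosetInd N (x - z) • w κ l z) * k l := by
  simp only [kernelOpSum]
  refine Finset.sum_congr rfl fun l _ => ?_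
  rw [← tsum_mul_right]
  exact tsum_congr fun z => summand_const (w κ l) (k l) x z

/-- The coset zeroth-moment family of a SUMMABLE entry is summable (the window is bounded by `1`). [folklore] -/
theorem summable_coset_smul {f : (Fin d → ℤ) → ℝ} (hf : Summable f) (x : Fin d → ℤ) :
    Summable (fun z => cosetInd N (x - z) • f z) := by
  refine Summable.of_norm_bounded hf.abs (fun z => ?_)
  rw [Real.norm_eq_abs, zsmul_eq_mul, abs_mul]
  exact mul_le_of_le_one_left (abs_nonneg _) (abs_cosetInd_le_one N (x - z))

/-- The coset zeroth moment of an entry, as an unconditional sum. [folklore] -/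
noncomputable def cM0Sum (N : ℕ) (f : (Fin d → ℤ) → ℝ) (x : Fin d → ℤ) : ℝ := ∑' z, cosetInd N (x - z) • f z

/-- The coset first moment (coordinate `j`) of an entry, as an unconditional sum. [folklore] -/
noncomputable def cM1Sum (N : ℕ) (f : (Fin d → ℤ) → ℝ) (j : Fin d) (x : Fin d → ℤ) : ℝ :=
  ∑' z, (cosetInd N (x - z) * z j) • f z

/-- `cM0Sum` IS the sum of its family for a summable entry. [folklore] -/
theorem hasSum_cM0Sum {f : (Fin d → ℤ) → ℝ} (hf : Summable f) (x : Fin d → ℤ) :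
    HasSum (fun z => cosetInd N (x - z) • f z) (cM0Sum N f x) :=
  (summable_coset_smul hf x).hasSum

/-- `cM1Sum` IS the sum of its family for an entry with absolutely summable second moments. [folklore] -/
theorem hasSum_cM1Sum {f : (Fin d → ℤ) → ℝ} (hf : AbsMoment₂ f) (j : Fin d) (x : Fin d → ℤ) :
    HasSum (fun z => (cosetInd N (x - z) * z j) • f z) (cM1Sum N f j x) :=
  (summable_window_smul_of_absMoment₂ hf (χ := fun z => cosetInd N (x - z))
    (fun z => abs_cosetInd_le_one N (x - z)) (IsMoment₂.coord j)).hasSum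

/-- CONSISTENCY: on finitely supported entries `cM0Sum` IS `KernelRepresentation.cM0`. [folklore] -/
theorem cM0Sum_finsupp (w : Fin d → Fin d → LatFun d ℝ) (κ l : Fin d) (x : Fin d → ℤ) :
    cM0Sum N ⇑(w κ l) x = cM0 N w κ l x := by
  simp only [cM0Sum, cM0, moment, Finsupp.sum]
  exact tsum_eq_sum fun z hz => by rw [Finsupp.notMem_support_iff.1 hz, smul_zero]

/-- CONSISTENCY: on finitely supported entries `cM1Sum` IS `KernelRepresentation.cM1`. [folklore] -/
theorem cM1Sum_finsupp (w : Fin d → Fin d → LatFun d ℝ) (κ l j : Fin d) (x : Fin d → ℤ) :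
    cM1Sum N ⇑(w κ l) j x = cM1 N w κ l j x := by
  simp only [cM1Sum, cM1, moment, Finsupp.sum]
  exact tsum_eq_sum fun z hz => by rw [Finsupp.notMem_support_iff.1 hz, smul_zero]

/-- **(L0∞) FROM REPRODUCTION OF CONSTANTS.**  If the kernel map with SUMMABLE entries reproduces every constant fine
1-form from its block sum, `K (𝒬 (cst c)) = cst c`, then every entry satisfies
`DecimatedMomentSummable.ConstReproSum N (w κ l) (δ_{κl} / N^(d+1))`: the coset zeroth-moment family through EVERY
coset has the sum `δ_{κl}/N^(d+1)`. [folklore] -/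
theorem constReproSum_of_reproduces (hN : N ≠ 0) (w : Fin d → Fin d → (Fin d → ℤ) → ℝ) (hw : ∀ κ l, Summable (w κ l))
    (h : ∀ c : Fin d → ℝ, kernelOpSum N w (contourSum N (cst c)) = cst c) (κ l : Fin d) :
    ConstReproSum N (w κ l) (if κ = l then ((N : ℝ) ^ (d + 1))⁻¹ else 0) := by
  intro a
  have hNp : ((N : ℝ) ^ (d + 1)) ≠ 0 := pow_ne_zero _ (by exact_mod_cast hN)
  have hs := hasSum_cM0Sum (N := N) (hw κ l) a
  have hx := congrFun (congrFun (h (Pi.single l 1)) κ) a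
  rw [contourSum_cst, kernelOpSum_cst, cst_apply] at hx
  simp only [Pi.single_apply, mul_ite, mul_one, mul_zero, Finset.sum_ite_eq', Finset.mem_univ, if_true] at hx
  -- hx : cM0-sum * N^(d+1) = if κ = l then 1 else 0
  by_cases hκ : κ = l
  · subst hκ
    simp only [if_true] at hx ⊢
    have e : (∑' z, cosetInd N (a - z) • w κ κ z) = ((N : ℝ) ^ (d + 1))⁻¹ := eq_inv_of_mul_eq_one_left hx
    unfold cM0Sum at hs
    rwa [e] at hs
  · simp only [hκ, if_false] at hx ⊢
    rcases mul_eq_zero.1 hx with h0 | h0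
    · unfold cM0Sum at hs
      rwa [h0] at hs
    · exact absurd h0 hNp

/-! ## §4 Affine data and (L1∞) -/

/-- The summand on AFFINE data `affine (N • m) γ`, cleared of its denominator under the coset indicator
(`KernelRepresentation.cosetInd_mul_quot`) and arranged along the two coset-moment families. [folklore] -/
theorem summand_affine_eq (f : (Fin d → ℤ) → ℝ) (m : Fin d → Fin d → ℝ) (γ : Fin d → ℝ) (l : Fin d) (x z : Fin d → ℤ) :
    summand N f (affine ((N : ℝ) • m) γ l) x z
      = (∑ j, m l j * ((x j : ℝ) * (cosetInd N (x - z) • f z) - (cosetInd N (x - z) * z j) • f z))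
        + γ l * (cosetInd N (x - z) • f z) := by
  have key := cosetInd_mul_quot (N := N) x z m γ l (f z)
  simp only [summand, affine, zsmul_eq_mul, Int.cast_mul] at key ⊢
  rw [key]
  have hs : (∑ j, m l j * ((x j : ℝ) * ((cosetInd N (x - z) : ℝ) * f z)
      - (cosetInd N (x - z) : ℝ) * (z j : ℝ) * f z))
      = ((cosetInd N (x - z) : ℝ) * f z) * ∑ j, m l j * ((x j : ℝ) - (z j : ℝ)) := by
    rw [Finset.mul_sum]
    exact Finset.sum_congr rfl fun j _ => by ring
  rw [hs]
  ring

/-- **The summand family on affine data HAS A SUM**, expressed through the sums `S0`, `S1 j` of the two coset-moment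
families: `Σ_j m_{lj} (x_j S0 − S1_j) + γ_l S0`. [folklore] -/
theorem hasSum_summand_affine (f : (Fin d → ℤ) → ℝ) (m : Fin d → Fin d → ℝ) (γ : Fin d → ℝ) (l : Fin d) (x : Fin d → ℤ)
    {S0 : ℝ} {S1 : Fin d → ℝ} (h0 : HasSum (fun z => cosetInd N (x - z) • f z) S0)
    (h1 : ∀ j, HasSum (fun z => (cosetInd N (x - z) * z j) • f z) (S1 j)) :
    HasSum (fun z => summand N f (affine ((N : ℝ) • m) γ l) x z)
      ((∑ j, m l j * ((x j : ℝ) * S0 - S1 j)) + γ l * S0) := by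
  have H := (hasSum_sum (s := Finset.univ)
    (fun j _ => ((h0.mul_left (x j : ℝ)).sub (h1 j)).mul_left (m l j))).add (h0.mul_left (γ l))
  exact H.congr_fun fun z => summand_affine_eq f m γ l x z

/-- Summability of the summand family on affine data, for an entry with absolutely summable second moments. [folklore] -/
theorem summable_summand_affine {f : (Fin d → ℤ) → ℝ} (hf : AbsMoment₂ f) (m : Fin d → Fin d → ℝ) (γ : Fin d → ℝ)
    (l : Fin d) (x : Fin d → ℤ) : Summable (fun z => summand N f (affine ((N : ℝ) • m) γ l) x z) :=
  (hasSum_summand_affine f m γ l x (hasSum_cM0Sum (summable_of_absMoment₂ hf) x)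
    (fun j => hasSum_cM1Sum hf j x)).summable

/-- … hence on every affine datum (`N ≠ 0`: `m = N • (N⁻¹ • m)`). [folklore] -/
theorem summable_summand_of_isAffine (hN : N ≠ 0) {f : (Fin d → ℤ) → ℝ} (hf : AbsMoment₂ f) {b : Form1 d ℝ}
    (hb : IsAffine b) (l : Fin d) (x : Fin d → ℤ) : Summable (fun z => summand N f (b l) x z) := by
  obtain ⟨m, c, rfl⟩ := hb
  have hNr : (N : ℝ) ≠ 0 := by exact_mod_cast hN
  have hm : m = (N : ℝ) • ((N : ℝ)⁻¹ • m) := by rw [smul_smul, mul_inv_cancel₀ hNr, one_smul]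
  rw [hm]
  exact summable_summand_affine hf _ c l x

/-- **ADDITIVITY ON AFFINE DATA** (field `H_add` of `InfiniteVolumeSpec`) for entries with absolutely summable second
moments. [folklore] -/
theorem kernelOpSum_add (hN : N ≠ 0) (w : Fin d → Fin d → (Fin d → ℤ) → ℝ) (hw : ∀ κ l, AbsMoment₂ (w κ l))
    {b b' : Form1 d ℝ} (hb : IsAffine b) (hb' : IsAffine b') :
    kernelOpSum N w (b + b') = kernelOpSum N w b + kernelOpSum N w b' :=
  kernelOpSum_add_of_summable w (fun κ l x => summable_summand_of_isAffine hN (hw κ l) hb l x)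
    (fun κ l x => summable_summand_of_isAffine hN (hw κ l) hb' l x)

/-- The field `H_cov` of `AffineReproduction.InfiniteVolumeSpec`, in its exact shape, for `H := kernelOpSum N w`.
[folklore] -/
theorem kernelOpSum_H_cov (hN : N ≠ 0) (w : Fin d → Fin d → (Fin d → ℤ) → ℝ) :
    ∀ (b : Form1 d ℝ) (a : Fin d → ℤ), IsAffine b →
      kernelOpSum N w (trans1 a b) = trans1 ((N : ℤ) • a) (kernelOpSum N w b) :=
  fun b a _ => kernelOpSum_trans1 hN w a b

/-- The field `H_add` of `AffineReproduction.InfiniteVolumeSpec`, in its exact shape, for `H := kernelOpSum N w` with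
entries of absolutely summable second moments. [folklore] -/
theorem kernelOpSum_H_add (hN : N ≠ 0) (w : Fin d → Fin d → (Fin d → ℤ) → ℝ) (hw : ∀ κ l, AbsMoment₂ (w κ l)) :
    ∀ b b' : Form1 d ℝ, IsAffine b → IsAffine b' →
      kernelOpSum N w (b + b') = kernelOpSum N w b + kernelOpSum N w b' :=
  fun _ _ hb hb' => kernelOpSum_add hN w hw hb hb'

/-- `kernelOpSum` on AFFINE coarse data `affine (N • m) γ`, in terms of the coset moments of the entries:
`Σ_l ( Σ_j m_{lj} (x_j · M0_{κl}(x) − M1_{κl,j}(x)) + γ_l · M0_{κl}(x) )` — the shape of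
`KernelRepresentation.kernelOp_affine` with `cM0Sum`/`cM1Sum` for `cM0`/`cM1`. [folklore] -/
theorem kernelOpSum_affine (w : Fin d → Fin d → (Fin d → ℤ) → ℝ) (hw : ∀ κ l, AbsMoment₂ (w κ l))
    (m : Fin d → Fin d → ℝ) (γ : Fin d → ℝ) (κ : Fin d) (x : Fin d → ℤ) :
    kernelOpSum N w (affine ((N : ℝ) • m) γ) κ x
      = ∑ l, ((∑ j, m l j * ((x j : ℝ) * cM0Sum N (w κ l) x - cM1Sum N (w κ l) j x))
          + γ l * cM0Sum N (w κ l) x) := by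
  simp only [kernelOpSum]
  exact Finset.sum_congr rfl fun l _ => (hasSum_summand_affine (w κ l) m γ l x
    (hasSum_cM0Sum (summable_of_absMoment₂ (hw κ l)) x) (fun j => hasSum_cM1Sum (hw κ l) j x)).tsum_eq

/-- **(L1∞) FROM REPRODUCTION OF AFFINE 1-FORMS.**  If the kernel map (entries with absolutely summable second moments)
reproduces every affine fine 1-form from its block sum, then every coset first-moment family of every entry has a sum
INDEPENDENT OF THE COSET: `∃ C, DecimatedMomentSummable.LinReproSum N (w κ l) C` — the algebra of
`KernelRepresentation.linRepro_of_reproduces`, verbatim, on the sums. [folklore] -/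
theorem linReproSum_of_reproduces (hN : N ≠ 0) (w : Fin d → Fin d → (Fin d → ℤ) → ℝ) (hw : ∀ κ l, AbsMoment₂ (w κ l))
    (h : ∀ (m : Fin d → Fin d → ℝ) (c : Fin d → ℝ), kernelOpSum N w (contourSum N (affine m c)) = affine m c)
    (κ l : Fin d) :
    ∃ C : Fin d → ℝ, LinReproSum N (w κ l) C := by
  have hNr : (N : ℝ) ≠ 0 := by exact_mod_cast hN
  have hNp : ((N : ℝ) ^ (d + 1)) ≠ 0 := pow_ne_zero _ hNr
  -- (L0∞) first, as the values of `cM0Sum`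
  have hL0 : ∀ l', ConstReproSum N (w κ l') (if κ = l' then ((N : ℝ) ^ (d + 1))⁻¹ else 0) := fun l' =>
    constReproSum_of_reproduces hN w (fun κ' l'' => summable_of_absMoment₂ (hw κ' l'')) (fun c => by
      have : (cst c : Form1 d ℝ) = affine 0 c := by funext κ' y; simp [affine, cst]
      rw [this]; exact h 0 c) κ l'
  have h0 : ∀ l' x, cM0Sum N (w κ l') x = if κ = l' then ((N : ℝ) ^ (d + 1))⁻¹ else 0 := fun l' x =>
    (hasSum_cM0Sum (summable_of_absMoment₂ (hw κ l')) x).unique (hL0 l' x)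
  -- the coarse data of the test form `affine (unitMat l j) 0`
  refine ⟨fun j => contourSum N (affine (unitMat l j) 0) κ 0 / ((N : ℝ) ^ (d + 1) * (N : ℝ) ^ (d + 1)), ?_⟩
  intro a j
  have hx := congrFun (congrFun (h (unitMat l j) 0) κ) a
  rw [contourSum_affine] at hx
  have hsm : ((N ^ (d + 2) : ℕ) • unitMat l j : Fin d → Fin d → ℝ) = (N : ℝ) • ((N : ℝ) ^ (d + 1) • unitMat l j) := by
    funext l' j'
    simp only [Pi.smul_apply, nsmul_eq_mul, smul_eq_mul, Nat.cast_pow]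
    ring
  rw [hsm, kernelOpSum_affine w hw] at hx
  simp only [h0] at hx
  -- evaluate the sums of `ite`s
  simp only [Pi.smul_apply, smul_eq_mul, unitMat, ite_and, mul_ite, mul_one, mul_zero, ite_mul, zero_mul,
    Finset.sum_ite_eq', Finset.mem_univ, if_true, affine, Pi.zero_apply, add_zero,
    Finset.sum_ite_irrel, Finset.sum_const_zero, Finset.sum_add_distrib, Finset.sum_ite_eq] at hx
  set t : ℝ := ((N : ℝ) ^ (d + 1))⁻¹ with htdef
  have ht : (N : ℝ) ^ (d + 1) * t = 1 := mul_inv_cancel₀ hNp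
  have hS := hasSum_cM1Sum (N := N) (hw κ l) j a
  suffices e : cM1Sum N (w κ l) j a
      = contourSum N (affine (unitMat l j) 0) κ 0 / ((N : ℝ) ^ (d + 1) * (N : ℝ) ^ (d + 1)) by
    rwa [e] at hS
  rw [eq_div_iff (mul_ne_zero hNp hNp)]
  by_cases hκ : κ = l
  · subst hκ
    simp only [if_true] at hx
    linear_combination (-(N : ℝ) ^ (d + 1)) * hx
      + (contourSum N (affine (unitMat κ j) 0) κ 0 + (N : ℝ) ^ (d + 1) * (a j : ℝ)) * ht
  · simp only [hκ, if_false] at hx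
    linear_combination (-(N : ℝ) ^ (d + 1)) * hx + (contourSum N (affine (unitMat l j) 0) κ 0) * ht

/-! ## §5 For every kernel-represented `InfiniteVolumeSpec` -/

/-- **(L0∞) FOR EVERY KERNEL-REPRESENTED SPEC** (summable entries) — by `AffineReproduction.round1`. [folklore] -/
theorem constReproSum_of_spec [NeZero N] (S : InfiniteVolumeSpec d N) (w : Fin d → Fin d → (Fin d → ℤ) → ℝ)
    (hw : ∀ κ l, Summable (w κ l)) (hrep : S.H = kernelOpSum N w) (κ l : Fin d) :
    ConstReproSum N (w κ l) (if κ = l then ((N : ℝ) ^ (d + 1))⁻¹ else 0) :=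
  constReproSum_of_reproduces (NeZero.ne N) w hw (fun c => by rw [← hrep]; exact (round1 S c).1) κ l

/-- … read in the `y`-form: EVERY ROW of the kernel `H_{κl}(x, y) = w_{κl}(x − N y)` of a kernel-represented spec
sums to `δ_{κl}/N^(d+1)`. [folklore] -/
theorem rowSum_of_spec [NeZero N] (S : InfiniteVolumeSpec d N) (w : Fin d → Fin d → (Fin d → ℤ) → ℝ)
    (hw : ∀ κ l, Summable (w κ l)) (hrep : S.H = kernelOpSum N w) (κ l : Fin d) (x : Fin d → ℤ) :
    HasSum (fun y : Fin d → ℤ => w κ l (x - (N : ℤ) • y)) (if κ = l then ((N : ℝ) ^ (d + 1))⁻¹ else 0) :=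
  (constReproSum_iff_decimated (NeZero.ne N) (w κ l) _).1 (constReproSum_of_spec S w hw hrep κ l) x

/-- **(L1∞) FOR EVERY KERNEL-REPRESENTED SPEC** (entries with absolutely summable second moments) — by
`AffineReproduction.hAff_of_spec`. [folklore] -/
theorem linReproSum_of_spec [NeZero N] (S : InfiniteVolumeSpec d N) (w : Fin d → Fin d → (Fin d → ℤ) → ℝ)
    (hw : ∀ κ l, AbsMoment₂ (w κ l)) (hrep : S.H = kernelOpSum N w) (κ l : Fin d) :
    ∃ C : Fin d → ℝ, LinReproSum N (w κ l) C :=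
  linReproSum_of_reproduces (NeZero.ne N) w hw (fun m c => by rw [← hrep]; exact hAff_of_spec S m c) κ l

/-- **THE BRIDGE (both moments)** for infinitely extended kernels: for an `InfiniteVolumeSpec` whose `H` is
`kernelOpSum N w` with entries of absolutely summable second moments, EVERY entry satisfies (L0∞) with mass
`δ_{κl}/N^(d+1)` AND (L1∞) with some constant vector — stated in exactly the binder shapes `hw0`/`hw1` consumed
downstream (the matrix packaging of the entrywise identities; an2 lineage, `EKer d = Fin d → Fin d → (Fin d → ℤ) → ℝ`):
`.1 : ∀ κ l, ConstReproSum N (w κ l) (if κ = l then ((N : ℝ) ^ (d + 1))⁻¹ else 0)`,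
`.2 : ∀ κ l, ∃ C : Fin d → ℝ, LinReproSum N (w κ l) C`. [folklore] -/
theorem lowMomentsSum_of_spec [NeZero N] (S : InfiniteVolumeSpec d N) (w : Fin d → Fin d → (Fin d → ℤ) → ℝ)
    (hw : ∀ κ l, AbsMoment₂ (w κ l)) (hrep : S.H = kernelOpSum N w) :
    (∀ κ l : Fin d, ConstReproSum N (w κ l) (if κ = l then ((N : ℝ) ^ (d + 1))⁻¹ else 0))
      ∧ ∀ κ l : Fin d, ∃ C : Fin d → ℝ, LinReproSum N (w κ l) C :=
  ⟨fun κ l => constReproSum_of_spec S w (fun κ' l' => summable_of_absMoment₂ (hw κ' l')) hrep κ l,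
    fun κ l => linReproSum_of_spec S w hw hrep κ l⟩

/-- **END TO END — the windowed second-moment identity for a kernel-represented spec with infinitely extended kernel.**
For an `InfiniteVolumeSpec` with `H = kernelOpSum N w` (entries with absolutely summable second moments), ANY two
entries `w κ l` (left pattern) and `w κ' l'` (right pattern), and any middle factor `T` with absolutely summable second
moments, vanishing sum and vanishing first moments ((T0)/(T1)), second moment `m₂` in the directions `μ, ν`:
the coset second-moment family of the dressed triple kernel has the sum `(δ_{κl}/N^(d+1)) · m₂ · n₀` (`n₀` = the sum
of the right pattern) — on `ℤ^d × ℤ^d × ℤ^d` (fine form) AND as the coset second moment of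
`DecimatedMomentSummable.dressedSum` over `ℤ^d` (coarse form). [folklore] -/
theorem decimatedSum_second_moment_of_spec [NeZero N] (S : InfiniteVolumeSpec d N)
    (w : Fin d → Fin d → (Fin d → ℤ) → ℝ) (hw : ∀ κ l, AbsMoment₂ (w κ l)) (hrep : S.H = kernelOpSum N w)
    (κ l κ' l' : Fin d) {T : (Fin d → ℤ) → ℝ} (hT : AbsMoment₂ T) (μ ν : Fin d) {m₂ n₀ : ℝ}
    (hT0 : HasSum T 0) (hT1μ : HasSum (fun t => t μ • T t) 0) (hT1ν : HasSum (fun t => t ν • T t) 0)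
    (h2 : HasSum (fun t => (t μ * t ν) • T t) m₂) (hn0 : HasSum (w κ' l') n₀) :
    HasSum (term (cosetInd N) (w κ l) T (w κ' l') (fun u t x => (t + x - u) μ * (t + x - u) ν))
        ((if κ = l then ((N : ℝ) ^ (d + 1))⁻¹ else 0) * m₂ * n₀)
      ∧ HasSum (fun y => (cosetInd N y * (y μ * y ν)) • dressedSum (w κ l) T (w κ' l') y)
        ((if κ = l then ((N : ℝ) ^ (d + 1))⁻¹ else 0) * m₂ * n₀) := by
  have hsw : ∀ κ₁ l₁, Summable (w κ₁ l₁) := fun κ₁ l₁ => summable_of_absMoment₂ (hw κ₁ l₁)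
  obtain ⟨C, hC⟩ := linReproSum_of_spec S w hw hrep κ l
  have A := decimatedSum_second_moment_hasSum N (w κ l) T (w κ' l') (constReproSum_of_spec S w hsw hrep κ l) hC
    (constReproSum_of_spec S w hsw hrep κ' l') μ ν hT0 hT1μ hT1ν h2 hn0
    (monoSummable_of_absMoment₂ (fun z => abs_cosetInd_le_one N z) (hw κ l) hT (hw κ' l'))
  exact ⟨A, hasSum_coarse (cosetInd N) (w κ l) T (w κ' l') (fun y => y μ * y ν) A
    (summable_dressed_fibre (hw κ l) hT (hw κ' l'))⟩

/-! ## §6 (T0∞)/(T1∞): the low moments of an infinitely extended middle factor from its two symmetries -/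

/-- Shift reindexing of a first-moment family: `Σ' y_κ • f (y − e)` has the sum `A + e_κ • B` when `Σ' y_κ • f y = A`
and `Σ' f = B` (`Equiv.addRight e`). [folklore] -/
theorem hasSum_first_shift {f : (Fin d → ℤ) → ℝ} {A B : ℝ} (κ : Fin d) (e : Fin d → ℤ)
    (h1 : HasSum (fun y : Fin d → ℤ => y κ • f y) A) (h0 : HasSum f B) :
    HasSum (fun y : Fin d → ℤ => y κ • f (y - e)) (A + e κ • B) := by
  refine (Equiv.hasSum_iff (Equiv.addRight e) (f := fun y : Fin d → ℤ => y κ • f (y - e))).1 ?_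
  refine (h1.add (h0.const_smul (e κ))).congr_fun fun y => ?_
  simp only [Function.comp_apply, Equiv.coe_addRight, Pi.add_apply, add_sub_cancel_right, add_smul]

/-- **(T0∞) FROM DIVERGENCE-FREENESS.**  For a matrix family `K μ ν : ℤ^d → ℝ` of entries with absolutely summable
second moments which is divergence-free in the first index (backward differences:
`Σ_μ (K_{μν}(x) − K_{μν}(x − e_μ)) = 0` for all `x`), EVERY entry has the sum `0` — the `tsum` version of
`DecimatedMoment.M0_eq_zero_of_divFree` (pair the identity with the weight `x_κ` and telescope). [folklore] -/
theorem hasSum_zero_of_divFree (K : Fin d → Fin d → (Fin d → ℤ) → ℝ) (hK : ∀ μ ν, AbsMoment₂ (K μ ν))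
    (hdiv : ∀ ν x, ∑ μ, (K μ ν x - K μ ν (x - Pi.single μ 1)) = 0) (κ ν : Fin d) : HasSum (K κ ν) 0 := by
  have hA : ∀ μ, HasSum (fun y : Fin d → ℤ => y κ • K μ ν y) (∑' y : Fin d → ℤ, y κ • K μ ν y) := fun μ =>
    (summable_smul_of_absMoment₂ (hK μ ν) (IsMoment₂.coord κ)).hasSum
  have hB : ∀ μ, HasSum (K μ ν) (∑' y, K μ ν y) := fun μ => (summable_of_absMoment₂ (hK μ ν)).hasSum
  have hS := hasSum_sum (s := (Finset.univ : Finset (Fin d)))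
    (fun μ _ => (hA μ).sub (hasSum_first_shift κ (Pi.single μ 1) (hA μ) (hB μ)))
  have hZ : HasSum (fun y : Fin d → ℤ =>
      ∑ μ ∈ (Finset.univ : Finset (Fin d)), (y κ • K μ ν y - y κ • K μ ν (y - Pi.single μ 1))) 0 := by
    have h0 : (fun y : Fin d → ℤ =>
        ∑ μ ∈ (Finset.univ : Finset (Fin d)), (y κ • K μ ν y - y κ • K μ ν (y - Pi.single μ 1)))
        = fun _ => 0 := by
      funext y
      simp only [← smul_sub, ← Finset.smul_sum, hdiv ν y, smul_zero]
    rw [h0]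
    exact hasSum_zero
  have e := hS.unique hZ
  simp only [Pi.single_apply, ite_smul, one_smul, zero_smul, sub_add_cancel_left, Finset.sum_neg_distrib,
    Finset.sum_ite_eq, Finset.mem_univ, if_true, neg_eq_zero] at e
  have h := hB κ
  rwa [e] at h

/-- **(T1∞) FROM AN INVERSION SYMMETRY.**  An entry with absolutely summable second moments, even about a lattice
midpoint (`f (c − y) = f y`) and of sum `0`, has all first moments `0` — the `tsum` version of
`DecimatedMoment.M1_eq_zero_of_inversion` (reindex by `y ↦ c − y`: `M1 = c • M0 − M1`). [folklore] -/
theorem hasSum_first_zero_of_inversion {f : (Fin d → ℤ) → ℝ} (hf : AbsMoment₂ f) (c : Fin d → ℤ)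
    (hinv : ∀ y, f (c - y) = f y) (h0 : HasSum f 0) (κ : Fin d) :
    HasSum (fun y : Fin d → ℤ => y κ • f y) 0 := by
  have hA := (summable_smul_of_absMoment₂ hf (IsMoment₂.coord κ)).hasSum
  have hR : HasSum (fun y : Fin d → ℤ => y κ • f y) (c κ • (0 : ℝ) - ∑' y : Fin d → ℤ, y κ • f y) := by
    refine (Equiv.hasSum_iff (Equiv.subLeft c) (f := fun y : Fin d → ℤ => y κ • f y)).1 ?_
    refine ((h0.const_smul (c κ)).sub hA).congr_fun fun y => ?_
    simp only [Function.comp_apply, Equiv.subLeft_apply, Pi.sub_apply, hinv, sub_smul]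
  have e := hA.unique hR
  rw [smul_zero, zero_sub] at e
  have hA0 : ∑' y : Fin d → ℤ, y κ • f y = 0 := by linarith
  rwa [hA0] at hA

/-- **(T0∞) ∧ (T1∞) for a kernel family with the two position-space symmetries** — divergence-free in the first index
(backward differences) and even about the midpoint offset `e_ν − e_μ` — : all sums AND all first moments of every
entry vanish: the hypotheses `hT0`, `hT1μ`, `hT1ν` of `decimatedSum_second_moment_of_spec` for `T := K μ ν`; the
`tsum` version of `DecimatedMoment.low_moments_of_symmetries`. [folklore] -/
theorem lowMomentsSum_of_symmetries (K : Fin d → Fin d → (Fin d → ℤ) → ℝ) (hK : ∀ μ ν, AbsMoment₂ (K μ ν))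
    (hdiv : ∀ ν x, ∑ μ, (K μ ν x - K μ ν (x - Pi.single μ 1)) = 0)
    (hinv : ∀ μ ν y, K μ ν ((Pi.single ν 1 - Pi.single μ 1) - y) = K μ ν y) :
    (∀ μ ν, HasSum (K μ ν) 0) ∧ ∀ κ μ ν, HasSum (fun y : Fin d → ℤ => y κ • K μ ν y) 0 := by
  have h0 : ∀ μ ν, HasSum (K μ ν) 0 := fun μ ν => hasSum_zero_of_divFree K hK hdiv μ ν
  exact ⟨h0, fun κ μ ν => hasSum_first_zero_of_inversion (hK μ ν) _ (hinv μ ν) (h0 μ ν) κ⟩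

end Literature.MathematicalPhysics.QuantumFieldTheory.Balaban1983to89.Beta.KernelRepresentationSummable
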